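import Literature.AlgebraicGeometry.Resolution.ResolutionOfSingularities
import Literature.AlgebraicGeometry.Motives.VarietiesProjectiveSpaceProofs
import Literature.AlgebraicGeometry.Motives.VarietiesGeometricallyIntegralProofs
import Mathlib.AlgebraicGeometry.Noetherian
import Mathlib.RingTheory.RegularLocalRing.Polynomial
import HarnessLib

/-!
# Regularity is affine-local; projective space over a field is a regular integral scheme

Topic: `Literature/AlgebraicGeometry/Resolution`. Layer 2c of the decomposition of the named fact
`Hironaka1964` (see `PrincipalizationToResolution.lean`): to feed Chow's lemma
(`ChowLemmaIntegral`, an immersion into `𝐏ⁿ_k`) into Kollár's Cor. 3.22 (resolution of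
subvarieties of a *regular* ambient scheme) one needs that `𝐏ⁿ_k = Proj k[x₀,…,xₙ]`
(`Literature.projectiveSpace n k`) is a regular integral scheme. Everything about `𝐏ⁿ_k` that this
requires is already in the tree — the chart isomorphism
`Literature.ProjectiveSpace.chartAlgEquiv : (k[x₀,…,xₙ]_{xᵢ})₀ ≃ₐ[k] k[y₁,…,yₙ]`, the chart cover
`Literature.AlgebraicGeometry.Motives.ProjectiveSpace.chartCover` (`Motives/VarietiesProjectiveSpaceProofs.lean`), smoothness and
geometric integrality (`Literature.AlgebraicGeometry.Motives.isSmoothProjective_projectiveSpace_holds`,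
`Literature.AlgebraicGeometry.Motives.IsSmoothProjective.isIntegral_holds`), properness (`Literature.AlgebraicGeometry.Motives.isProper_projectiveSpace`,
`Motives/VarietiesProperProofs.lean`) — except regularity (Mathlib does not yet know that smooth
schemes over a field are regular). This file supplies it through the affine-local description of
regularity (Mathlib's `IsRegularRing`: Noetherian, all localisations at primes regular) and the
regularity of polynomial rings over a field (Mathlib `MvPolynomial.isRegularRing_of_isRegularRing`).
All statements are folklore and PROVED:

* `Scheme.IsRegular.isRegularRing_of_isAffineOpen`, `Scheme.isRegular_of_isRegularRing`,
  `Scheme.isRegular_Spec`, `Scheme.isRegular_Spec_iff`,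
  `Scheme.IsRegular.of_forall_exists_isOpenImmersion` (converse direction of
  `Scheme.IsRegular.of_isOpenImmersion`, `AlterationsProofs.lean`),
  `Scheme.isReduced_of_forall_exists_isOpenImmersion`;
* `isRegularRing_chart` — the chart rings `(k[x]_{xᵢ})₀ ≅ k[y₁,…,yₙ]` are regular;
  **`isRegular_projectiveSpace`** — `𝐏ⁿ_k` is a regular scheme (Görtz–Wedhorn,
  *Algebraic Geometry I*, Example 6.16 (1) with Lemma 6.26); `isIntegral_projectiveSpace` — `𝐏ⁿ_k`
  is integral (a one-line consequence of the tree's smooth-projective-variety facts, recorded for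
  the consumers in this topic).

## Sources

* The Stacks Project, Tag 02IS (regular schemes; affine-local). [StacksProject]
* U. Görtz, T. Wedhorn, *Algebraic Geometry I*, 2nd ed. (2020), Example 6.16 (1), Lemma 6.26.
  [GortzWedhorn2020]
* R. Hartshorne, *Algebraic Geometry*, GTM 52, Prop. II.2.5 (the charts `D₊(xᵢ)`). [Hartshorne1977]
-/

noncomputable section

open MvPolynomial HomogeneousLocalization CategoryTheory AlgebraicGeometry TopologicalSpace

namespace Literature.AlgebraicGeometry.Resolution

universe u

/-! ## Regularity is affine-local -/

section AffineLocal

variable {X : Scheme.{u}}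

/-- Over an affine open `U` of a locally Noetherian regular scheme, `Γ(X, U)` is a regular ring:
its localisation at a prime `y` is the local ring of `X` at the corresponding point of `U`.
[cite: StacksProject, Tag 02IS] -/
theorem Scheme.IsRegular.isRegularRing_of_isAffineOpen [IsLocallyNoetherian X]
    (hX : Scheme.IsRegular X) {U : X.Opens} (hU : IsAffineOpen U) : IsRegularRing Γ(X, U) := by
  haveI : IsNoetherianRing Γ(X, U) := IsLocallyNoetherian.component_noetherian ⟨U, hU⟩
  rw [isRegularRing_iff]
  intro p hp
  let y : PrimeSpectrum Γ(X, U) := ⟨p, hp⟩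
  have hy : hU.fromSpec y ∈ U := by
    rw [← SetLike.mem_coe, ← hU.range_fromSpec]; exact ⟨y, rfl⟩
  letI : Algebra Γ(X, U) (X.presheaf.stalk (hU.fromSpec y)) :=
    TopCat.Presheaf.algebra_section_stalk X.presheaf ⟨hU.fromSpec y, hy⟩
  haveI : IsLocalization.AtPrime (X.presheaf.stalk (hU.fromSpec y)) y.asIdeal :=
    hU.isLocalization_stalk' y hy
  haveI := hX (hU.fromSpec y)
  exact IsRegularLocalRing.of_ringEquiv
    (IsLocalization.algEquiv y.asIdeal.primeCompl (X.presheaf.stalk (hU.fromSpec y))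
      (Localization.AtPrime y.asIdeal)).toRingEquiv

/-- A scheme each of whose points lies in an affine open with a regular ring of sections is
regular. [cite: StacksProject, Tag 02IS] -/
theorem Scheme.isRegular_of_isRegularRing
    (h : ∀ x : X, ∃ U : X.Opens, IsAffineOpen U ∧ x ∈ U ∧ IsRegularRing Γ(X, U)) :
    Scheme.IsRegular X := by
  intro x
  obtain ⟨U, hU, hxU, hreg⟩ := h x
  letI : Algebra Γ(X, U) (X.presheaf.stalk x) :=
    TopCat.Presheaf.algebra_section_stalk X.presheaf ⟨x, hxU⟩
  haveI : IsLocalization.AtPrime (X.presheaf.stalk x) (hU.primeIdealOf ⟨x, hxU⟩).asIdeal :=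
    hU.isLocalization_stalk ⟨x, hxU⟩
  haveI := hreg
  exact IsRegularLocalRing.of_ringEquiv
    (IsLocalization.algEquiv (hU.primeIdealOf ⟨x, hxU⟩).asIdeal.primeCompl
      (Localization.AtPrime (hU.primeIdealOf ⟨x, hxU⟩).asIdeal) (X.presheaf.stalk x)).toRingEquiv

/-- The spectrum of a regular ring is a regular scheme. [cite: StacksProject, Tag 02IS] -/
theorem Scheme.isRegular_Spec (R : CommRingCat.{u}) [IsRegularRing R] :
    Scheme.IsRegular (Spec R) :=
  Scheme.isRegular_of_isRegularRing fun _ =>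
    ⟨⊤, isAffineOpen_top _, trivial,
      IsRegularRing.of_ringEquiv (Scheme.ΓSpecIso R).commRingCatIsoToRingEquiv.symm⟩

/-- For a Noetherian ring, `Spec R` is regular iff `R` is a regular ring.
[cite: StacksProject, Tag 02IS] -/
theorem Scheme.isRegular_Spec_iff (R : CommRingCat.{u}) [IsNoetherianRing R] :
    Scheme.IsRegular (Spec R) ↔ IsRegularRing R := by
  refine ⟨fun h => ?_, fun _ => Scheme.isRegular_Spec R⟩
  haveI := h.isRegularRing_of_isAffineOpen (isAffineOpen_top (Spec R))
  exact IsRegularRing.of_ringEquiv (Scheme.ΓSpecIso R).commRingCatIsoToRingEquiv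

/-- Regularity may be checked after pulling back to a jointly surjective family of open
immersions. [folklore] -/
theorem Scheme.IsRegular.of_forall_exists_isOpenImmersion
    (h : ∀ x : X, ∃ (U : Scheme.{u}) (j : U ⟶ X), IsOpenImmersion j ∧ x ∈ Set.range j ∧
      Scheme.IsRegular U) : Scheme.IsRegular X := by
  intro x
  obtain ⟨U, j, _, ⟨u, rfl⟩, hU⟩ := h x
  haveI := hU u
  exact IsRegularLocalRing.of_ringEquiv (asIso (j.stalkMap u)).commRingCatIsoToRingEquiv.symm

/-- Likewise for reducedness. [folklore] -/
theorem Scheme.isReduced_of_forall_exists_isOpenImmersion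
    (h : ∀ x : X, ∃ (U : Scheme.{u}) (j : U ⟶ X), IsOpenImmersion j ∧ x ∈ Set.range j ∧
      IsReduced U) : IsReduced X := by
  haveI : ∀ x : X, _root_.IsReduced (X.presheaf.stalk x) := fun x => by
    obtain ⟨U, j, _, ⟨u, rfl⟩, hU⟩ := h x
    haveI := hU
    exact isReduced_of_injective (asIso (j.stalkMap u)).commRingCatIsoToRingEquiv
      (asIso (j.stalkMap u)).commRingCatIsoToRingEquiv.injective
  exact isReduced_of_isReduced_stalk X

end AffineLocal

/-! ## `𝐏ⁿ_k` is regular and integral -/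

section ProjectiveSpace

variable (n : ℕ) (k : Type u) [Field k]

attribute [local instance] MvPolynomial.gradedAlgebra Motives.ProjBaseChange.algebraBase
  Motives.ProjBaseChange.isScalarTower_localization

/-- The chart rings `(k[x₀,…,xₙ]_{xᵢ})₀ ≅ k[y₁,…,yₙ]` of `𝐏ⁿ_k` (`Literature.AlgebraicGeometry.Motives.ProjectiveSpace.chartAlgEquiv`)
are regular rings (`k` regular ⟹ `k[y₁,…,yₙ]` regular). [folklore] -/
theorem isRegularRing_chart (i : Fin (n + 1)) :
    IsRegularRing (Away (MvPolynomial.homogeneousSubmodule (Fin (n + 1)) k)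
      (X i : MvPolynomial (Fin (n + 1)) k)) :=
  IsRegularRing.of_ringEquiv (Literature.AlgebraicGeometry.Motives.ProjectiveSpace.chartAlgEquiv k i).symm.toRingEquiv

/-- **Projective space over a field is a regular scheme** (`Literature.projectiveSpace n k`, i.e.
`Proj k[x₀,…,xₙ]`): it is covered (`Literature.AlgebraicGeometry.Motives.ProjectiveSpace.chartCover`) by the spectra of the regular
rings `(k[x]_{xᵢ})₀ ≅ k[y₁,…,yₙ]` (Görtz–Wedhorn, *Algebraic Geometry I*, Example 6.16 (1) with
Lemma 6.26; Hartshorne II.2.5). [folklore] -/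
theorem isRegular_projectiveSpace : Scheme.IsRegular (Literature.AlgebraicGeometry.Motives.projectiveSpace n k).left := by
  apply Scheme.IsRegular.of_forall_exists_isOpenImmersion
  intro x
  obtain ⟨y, hy⟩ := (Literature.AlgebraicGeometry.Motives.ProjectiveSpace.chartCover n k).covers x
  exact ⟨_, (Literature.AlgebraicGeometry.Motives.ProjectiveSpace.chartCover n k).f _, inferInstance, ⟨y, hy⟩,
    @Scheme.isRegular_Spec _ (isRegularRing_chart n k ((Literature.AlgebraicGeometry.Motives.ProjectiveSpace.chartCover n k).idx x))⟩

/-- `𝐏ⁿ_k` is an integral scheme — a smooth projective geometrically irreducible `k`-variety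
(`Literature.AlgebraicGeometry.Motives.isSmoothProjective_projectiveSpace_holds`) is integral
(`Literature.AlgebraicGeometry.Motives.IsSmoothProjective.isIntegral_holds`); recorded here for the consumers in this topic.
[folklore] -/
theorem isIntegral_projectiveSpace : IsIntegral (Literature.AlgebraicGeometry.Motives.projectiveSpace n k).left :=
  Literature.AlgebraicGeometry.Motives.IsSmoothProjective.isIntegral_holds (Literature.AlgebraicGeometry.Motives.isSmoothProjective_projectiveSpace_holds k n)

end ProjectiveSpace

end Literature.AlgebraicGeometry.Resolution

end
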